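import Literature.AlgebraicGeometry.AbelianSchemes.PoincarePullbackKernelCountGeometric   -- ★ (i) `finite_and_ncard_le_natCard_kerPoints_of_etale`
import Literature.AlgebraicGeometry.AbelianSchemes.TorsionSectionPairingDualIsogeny      -- ★ `nonempty_pullbackP_comp_dualIsogenyOver_iso`, `nonempty_pullback_baseChangeHom_unit_iso_unit`
import Literature.AlgebraicGeometry.AbelianSchemes.DualIsogenyDegreeFibre                -- ★ `fibreHom_dualIsogenyOver_eq_dualHom`, `isIsogeny_fibreHom_dualIsogenyOver`; ★ `DualIsogenyDegree`
import Literature.AlgebraicGeometry.AbelianSchemes.AbelianSchemeDualIsogenyHom           -- ★ `isMonHom_dualIsogenyOver`, `nonempty_pullbackP_comp_unitSection_iso`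
import Literature.AlgebraicGeometry.AbelianSchemes.FibrePointsMulEquivPoints             -- ★ `exists_mulEquiv_fibrePoints_points_map_eq_one_iff`
import Literature.AlgebraicGeometry.AbelianSchemes.DualPairHatIsOfRelDim                 -- ★ `DualPair.isOfRelDim_hat`
import Literature.AlgebraicGeometry.AbelianSchemes.DualPairHatRelDimTransport            -- ★ `DualPair.dim_hat_toAbelianVariety_eq_of_isOfRelDim`, `isOfRelDim_dim_toAffine`
import Literature.AlgebraicGeometry.Motives.AbelianVarietyIsogenyEtale                   -- ★ `IsIsogeny.etale`, `IsIsogeny.natCard_kerPoints_eq_kerRank_of_charZero`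
import HarnessLib

/-!
# The degree of the dual isogeny: `deg ψ^∨ = deg ψ` over algebraically closed fields of characteristic `0`, from ONE inequality and
# TWO product laws ([MumfordAV1970] §15 Thm. 1; [GortzWedhorn2023] Prop. 27.213 (3))

Layer `Literature/AlgebraicGeometry/AbelianSchemes`, namespaces `Literature.AlgebraicGeometry.AbelianSchemes.AbelianSchemeOver(.DualPair)`.
THEOREMS ONLY (no definition, no named fact, no instance, no notation, no `sorry`).  Cell `hodgecm-mathlib` (D-0151), P6 «MOD programme» (crux
hLiu418 = stmt-HodgeConjecture-24832, `--supports`, count-neutral), half-A lines L2 (`stub_DOWN`, (ρ2‴) «roof degree chain») and L3 (`stub_ROOF0`,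
(ρ-deg)(i) «`rk Γ(Ker q̄) = q²`»): organ **(B2) «`#Ker ψ^∨ = #Ker ψ`»** (LA1-plan (g3) deal 2026-09-02T07:01Z; pen LA1-p01 (g3)); it DISCHARGES the named
fact ★ `GortzWedhorn2023.Ch27DualityRows.Prop_27_213_3_deg` («`deg f = deg f^t`», [GortzWedhorn2023] Prop. 27.213 (3)) over algebraically closed
fields of characteristic `0`.  HONEST LABEL: HC_CM is proved only modulo the 7 printed citations (2 remaining: hLiu418 = stmt-HodgeConjecture-24832, h413 =
stmt-HodgeConjecture-24833) until rung 0 closes; this file is generic and discharges none of them.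

THE MATHEMATICS.  `ψ : A′ → B` a homomorphism of abelian schemes with dual pairs `D′ = (Â′, 𝒫′)`, `D_B = (B̂, 𝒫_B)` (unit-normalised), `ψ^∨ : B̂ → Â′`
its dual (★ `dualIsogenyOver`).  (§1, THE SEAM) For a point `c : T → B̂` over `f : T → S`, `(1 × (c ≫ ψ^∨))^*𝒫′ ≅ ψ_T^*((1 × c)^*𝒫_B)` (★
`nonempty_pullbackP_comp_dualIsogenyOver_iso`); at a field-valued point, by the uniqueness in the universal property of `D′` (★ `eq_of_nonempty_iso`)
and the unit normalisation (★ `nonempty_pullbackP_comp_unitSection_iso`): **`c ≫ ψ^∨ = 1 ⟺ ψ_t^*(𝒫_B)_c ≅ 𝒪`** — the `Ω`-points of `Ker ψ^∨` ARE the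
set `T_t = {b ∈ B̂_t(Ω) | (1 × b)^*(ψ × 1)^*𝒫_B ≅ 𝒪}` of ★ `PoincarePullbackKernelCountGeometric`.  (§2) Hence, at a geometric point `t` where `ψ_t` is
an ÉTALE isogeny, the injectivity half of [MumfordAV1970] §15 Thm. 1 (★ `finite_and_ncard_le_natCard_kerPoints_of_etale`, [SGA1] V 2.6 inside) reads
**`#Ker (ψ^∨)_t(Ω) ≤ #Ker ψ_t(Ω)`**, and in characteristic `0` (all isogenies étale, ★ `IsIsogeny.etale`; `#Ker(Ω̄) = deg`, ★
`IsIsogeny.natCard_kerPoints_eq_kerRank_of_charZero`) **`deg (ψ^∨)_t ≤ deg ψ_t`**.  (§3) Over an algebraically closed field `k` of characteristic `0`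
(`S = Spec k`, the fibre at the tautological point `Spec k → Spec k` has the degree of `ψ` itself, §3 `kerRank_fibreHom_eq_kerRank_homOfIsMonHom`):
**`deg ψ^∨ ≤ deg ψ`** for every isogeny `ψ`.  (§4, THE SQUEEZE) With a quasi-inverse `g`, `g ≫ ψ = [n]_B` (★ `IsIsogeny.exists_nsmul_inverse_holds`):
`deg g · deg ψ = n^{2 dim B}` (★ `IsIsogeny.kerRank_mul_eq_of_comp_eq_nsmul_id`) and `deg ψ^∨ · deg g^∨ = n^{2 dim B̂} = n^{2 dim B}` (★
`kerRank_dualHom_mul_kerRank_dualHom_eq`, ★ `dim_hat`); with `deg ψ^∨ ≤ deg ψ` AND `deg g^∨ ≤ deg g` the two products squeeze: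
**`deg ψ^∨ = deg ψ`** — NO biduality and NO Cartier duality `Ker ψ^∨ ≅ (Ker ψ)^D` are used (the latter is not in the tree; cf. the docstring of ★
`Prop_27_213_3_deg`).  The `Ω`-points twin `#Ker ψ^∨(k) = #Ker ψ(k)` follows (★ char-0 count).

* §1 `one_left_eq_comp_unitSection`; **`DualPair.comp_dualIsogenyOver_eq_one_iff`** (the seam, any field-valued point);
  `DualPair.setOf_nonempty_iso_unit_eq` (the set `T_t` of ★ (i) IS `{b | b ≫ ψ^∨ = 1}`).
* §2 `natCard_kerPoints_fibreHom_eq_natCard_subtype` (`#Ker φ_t(Ω) = #{u ∈ X_t(Ω)_S | u ≫ φ = 1}`, ★ `FibrePointsMulEquivPoints`),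
  **`DualPair.natCard_kerPoints_fibreHom_dualIsogenyOver_le`** (`#Ker (ψ^∨)_t(Ω) ≤ #Ker ψ_t(Ω)`, `ψ_t` étale isogeny),
  **`DualPair.kerRank_fibreHom_dualIsogenyOver_le`** (`deg (ψ^∨)_t ≤ deg ψ_t`, characteristic `0`).
* §3 (`S = Spec k`) `isIsogeny_fibreHom_of_isIsogeny_homOfIsMonHom`, `kerRank_fibreHom_eq_kerRank_homOfIsMonHom`, `DualPair.dualHom_eq_homOfIsMonHom`,
  **`DualPair.kerRank_dualHom_le`** (`deg ψ^∨ ≤ deg ψ`, `k = k̄`, char `0`).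
* §4 HEADS **`DualPair.kerRank_dualHom_eq`** (`deg ψ^∨ = deg ψ`), **`DualPair.natCard_kerPoints_dualHom_eq`** (`#Ker ψ^∨(k) = #Ker ψ(k)`), and
  **`DualPair.prop_27_213_3_deg_of_isAlgClosed_of_charZero`** — the body of ★ `GortzWedhorn2023.Ch27DualityRows.Prop_27_213_3_deg` for `k`
  algebraically closed of characteristic `0` (cited by name, not restated as a fact).

## References
* [MumfordAV1970] D. Mumford, *Abelian Varieties* (1970) — §15 Thm. 1 (p. 143); §19 Remark (p. 169) (quasi-inverses); §7 Thm. 4 (p. 72).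
* [GortzWedhorn2023] U. Görtz, T. Wedhorn, *Algebraic Geometry II* (2023) — Prop. 27.213 (3) (p. 687); Prop. 27.186, 27.187; Cor. 27.177 (1).
* [MilneAV2008] J. S. Milne, *Abelian Varieties* (2008) — I §8 pp. 36–37 (universal property of the dual), I §9 Thm. 9.1 (p. 42).
* [SGA1] A. Grothendieck, *SGA 1*, Exp. V Prop. 2.6 (inside ★ (i)).
-/

set_option autoImplicit false

noncomputable section

-- Mathlib's `Over`/`Scheme` APIs are stated across semireducible wrappers (as in ★ `DualIsogenyDegreeFibre`, ★ `PoincarePullbackKernelCountGeometric`).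
set_option backward.isDefEq.respectTransparency false

universe u

open CategoryTheory CategoryTheory.Limits AlgebraicGeometry MonoidalCategory CartesianMonoidalCategory
open scoped MonObj

namespace Literature.AlgebraicGeometry.AbelianSchemes

namespace AbelianSchemeOver

open Literature.AlgebraicGeometry.Motives Literature.AlgebraicGeometry.Motives.AbelianVariety

variable {S : Scheme.{u}}

/-! ## §1 The seam: `Ω`-points of `Ker ψ^∨` are the points `b` with `ψ_t^*(𝒫_B)_b ≅ 𝒪` -/

/-- The unit `T`-point of an abelian scheme `X`, on underlying schemes: `(1 : T → X).left = (T → S) ≫ ε_X` (Mathlib `Hom.one_def`,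
`Over.toUnit_left`). [cite: MumfordFogartyKirwan1994, Ch. 6 §1 Definition 6.1 (p. 115)] -/
theorem one_left_eq_comp_unitSection (X : AbelianSchemeOver S) {T : Scheme.{u}} (f : T ⟶ S) :
    (1 : Over.mk f ⟶ X.X).left = f ≫ X.unitSection := by
  rw [Hom.one_def, Over.comp_left, Over.toUnit_left]
  rfl

namespace DualPair

variable {A' B : AbelianSchemeOver S} (ψ : A'.X ⟶ B.X) [IsMonHom ψ] (D' : A'.DualPair) (DB : B.DualPair)
  (hD' : Nonempty ((Scheme.Modules.pullback (unitHatSlice D')).obj D'.P ≅ SheafOfModules.unit _))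

include hD' in
/-- **THE SEAM — `Ω`-POINTS OF `Ker ψ^∨`**: for a field-valued point `c` of `B̂` over `t : Spec Ω → S`, `c ≫ ψ^∨` is the unit point of `Â′` iff
`ψ_t^*((1 × c)^*𝒫_B) ≅ 𝒪` on `A′_t`.  Both `c ≫ ψ^∨` and the unit classify a rigidified family on `A′_t`: the former `(1 × (c ≫ ψ^∨))^*𝒫′ ≅
ψ_t^*(𝒫_B)_c` (★ `nonempty_pullbackP_comp_dualIsogenyOver_iso`), the latter `𝒪` (unit normalisation of `𝒫′`, ★ `nonempty_pullbackP_comp_unitSection_iso`);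
uniqueness in the universal property of `D′` (★ `eq_of_nonempty_iso` against the `𝒫′`-slice ★ `sliceBundle`). [cite: MumfordAV1970, §15 Thm. 1 (p. 143)]
[cite: MilneAV2008, I §8 pp. 36–37] -/
theorem comp_dualIsogenyOver_eq_one_iff {Ω : Type u} [Field Ω] (t : Spec (.of Ω) ⟶ S) (c : Over.mk t ⟶ DB.hat.X) :
    c ≫ dualIsogenyOver ψ D' DB = 1 ↔
      Nonempty ((Scheme.Modules.pullback (baseChangeHom ψ t).left).obj (DB.pullbackP t c.left (Over.w c)) ≅ SheafOfModules.unit _) := by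
  -- (K) `(1 × (c ≫ ψ^∨))^*𝒫′ ≅ ψ_t^*(𝒫_B)_c`
  obtain ⟨eK⟩ := nonempty_pullbackP_comp_dualIsogenyOver_iso ψ D' DB t c
  -- the unit point of `Â′` over `t` classifies `𝒪`
  have h1 : (1 : Over.mk t ⟶ D'.hat.X).left = t ≫ D'.hat.unitSection := one_left_eq_comp_unitSection D'.hat t
  have hf : (t ≫ D'.hat.unitSection) ≫ D'.hat.X.hom = t := by rw [Category.assoc, D'.hat.unitSection_comp_hom, Category.comp_id]
  obtain ⟨eU⟩ := D'.nonempty_pullbackP_comp_unitSection_iso t hD' hf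
  have eU' : D'.pullbackP t (1 : Over.mk t ⟶ D'.hat.X).left (Over.w _) ≅ SheafOfModules.unit _ :=
    eqToIso (D'.pullbackP_congr t h1 (Over.w _) hf) ≪≫ eU
  constructor
  · intro h
    have hl : (c ≫ dualIsogenyOver ψ D' DB).left = (1 : Over.mk t ⟶ D'.hat.X).left := by rw [h]
    exact ⟨eK.symm ≪≫ eqToIso (D'.pullbackP_congr t hl (Over.w _) (Over.w _)) ≪≫ eU'⟩
  · rintro ⟨e⟩
    apply Over.OverMorphism.ext
    -- both `c ≫ ψ^∨` and `1` classify the (trivial) `𝒫′`-slice at the unit point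
    exact D'.eq_of_nonempty_iso t (D'.sliceBundle (1 : Over.mk t ⟶ D'.hat.X).left t (Over.w _))
      (D'.sliceBundle_fibrewisePicZero _ t _) (c ≫ dualIsogenyOver ψ D' DB).left (1 : Over.mk t ⟶ D'.hat.X).left
      (Over.w _) (Over.w _) ⟨eK ≪≫ e ≪≫ eU'.symm⟩ ⟨Iso.refl _⟩

include hD' in
/-- **THE SET `T_t` OF ★ `PoincarePullbackKernelCountGeometric` IS `{b | b ≫ ψ^∨ = 1}`**: a field-valued point `b` of `B̂` over `t` satisfies
`(1_{A′} × b)^*((ψ × 1_{B̂})^*𝒫_B) ≅ 𝒪` iff `b ≫ ψ^∨ = 1` (★ `nonempty_pullback_baseChangeToProd_whiskerRight_iso` + the seam).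
[cite: MumfordAV1970, §15 Thm. 1 (p. 143)] [cite: MilneAV2008, I §8 pp. 36–37] -/
theorem setOf_nonempty_iso_unit_eq {Ω : Type u} [Field Ω] (t : Spec (.of Ω) ⟶ S) :
    {b : DB.hat.FibrePoints t | Nonempty ((Scheme.Modules.pullback (A'.baseChangeToProd DB.hat t b.left (Over.w b))).obj
        ((Scheme.Modules.pullback (ψ ▷ DB.hat.X).left).obj DB.P) ≅ SheafOfModules.unit _)} =
      {b : DB.hat.FibrePoints t | b ≫ dualIsogenyOver ψ D' DB = 1} := by
  ext b
  simp only [Set.mem_setOf_eq]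
  obtain ⟨e₁⟩ := DB.nonempty_pullback_baseChangeToProd_whiskerRight_iso (X := A') ψ t b.left (Over.w b)
  rw [comp_dualIsogenyOver_eq_one_iff ψ D' DB hD' t b]
  exact ⟨fun ⟨e⟩ => ⟨e₁.symm ≪≫ e⟩, fun ⟨e⟩ => ⟨e₁ ≪≫ e⟩⟩

end DualPair

/-! ## §2 Counting at a geometric point: `#Ker (ψ^∨)_t(Ω) ≤ #Ker ψ_t(Ω)`, and `deg (ψ^∨)_t ≤ deg ψ_t` in characteristic `0` -/

/-- **`#Ker φ_t(Ω) = #{u ∈ Hom_S(Spec Ω, X) | u ≫ φ = 1}`**: the kernel of the fibre homomorphism `φ_t` on `Ω`-points, counted in the currency of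
`S`-morphisms `Spec Ω → X` over `t` (★ `exists_mulEquiv_fibrePoints_points_map_eq_one_iff`: a group isomorphism compatible with kernels).
[cite: GortzWedhorn2020, Section (4.7), (4.7.1) (p. 108)] [cite: MumfordFogartyKirwan1994, Ch. 6 §2 Definition 6.3 (p. 120)] -/
theorem natCard_kerPoints_fibreHom_eq_natCard_subtype (X : AbelianSchemeOver S) {Y : AbelianSchemeOver S} (φ : X.X ⟶ Y.X) [IsMonHom φ]
    {Ω : Type u} [Field Ω] (t : Spec (.of Ω) ⟶ S) :
    Nat.card (Hom.kerPoints (specOver Ω Ω) (fibreHom φ t)) = Nat.card {u : X.FibrePoints t // u ≫ φ = 1} := by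
  obtain ⟨e, -, he⟩ := X.exists_mulEquiv_fibrePoints_points_map_eq_one_iff t φ
  refine Nat.card_congr (e.toEquiv.symm.subtypeEquiv fun P => ?_)
  obtain ⟨u, rfl⟩ := e.toEquiv.surjective P
  rw [Equiv.symm_apply_apply, ← he u]
  exact Hom.mem_kerPoints_iff _ _

namespace DualPair

variable {A' B : AbelianSchemeOver S} (ψ : A'.X ⟶ B.X) [IsMonHom ψ] (D' : A'.DualPair) (DB : B.DualPair)
  (hD' : Nonempty ((Scheme.Modules.pullback (unitHatSlice D')).obj D'.P ≅ SheafOfModules.unit _))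
  (hDB : Nonempty ((Scheme.Modules.pullback (unitHatSlice DB)).obj DB.P ≅ SheafOfModules.unit _))

include hD' in
/-- **`#Ker (ψ^∨)_t(Ω) ≤ #Ker ψ_t(Ω)` AT A GEOMETRIC POINT WHERE `ψ_t` IS AN ÉTALE ISOGENY** — the injectivity half of [MumfordAV1970] §15 Thm. 1
(★ `finite_and_ncard_le_natCard_kerPoints_of_etale`: the points `b` of `B̂_t` with `ψ_t^*(𝒫_B)_b ≅ 𝒪` are at most `#Ker ψ_t(Ω)` in number; they ARE the
`Ω`-points of `Ker ψ^∨` by §1). [cite: MumfordAV1970, §15 Thm. 1 (p. 143)] [cite: SGA1, Exp. V Prop. 2.6] -/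
theorem natCard_kerPoints_fibreHom_dualIsogenyOver_le {Ω : Type u} [Field Ω] [IsAlgClosed Ω] (t : Spec (.of Ω) ⟶ S)
    (hψ : IsIsogeny (fibreHom ψ t)) [Etale (Hom.toSchemeHom (fibreHom ψ t))] [IsMonHom (dualIsogenyOver ψ D' DB)] :
    Nat.card (Hom.kerPoints (specOver Ω Ω) (fibreHom (dualIsogenyOver ψ D' DB) t)) ≤
      Nat.card (Hom.kerPoints (specOver Ω Ω) (fibreHom ψ t)) := by
  have h := (DB.finite_and_ncard_le_natCard_kerPoints_of_etale ψ t hψ).2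
  rw [setOf_nonempty_iso_unit_eq ψ D' DB hD' t, ← Nat.card_coe_set_eq] at h
  rwa [natCard_kerPoints_fibreHom_eq_natCard_subtype DB.hat (dualIsogenyOver ψ D' DB) t]

include hD' hDB in
/-- **`deg (ψ^∨)_t ≤ deg ψ_t` IN CHARACTERISTIC `0`** (`Ω` algebraically closed of characteristic `0`, `ψ_t` an isogeny): all isogenies are étale (★
`IsIsogeny.etale`), `#Ker(Ω) = deg` (★ `IsIsogeny.natCard_kerPoints_eq_kerRank_of_charZero`), `(ψ^∨)_t` is an isogeny (★ `isIsogeny_fibreHom_dualIsogenyOver`),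
and the previous count. [cite: MumfordAV1970, §15 Thm. 1 (p. 143); §7 Thm. 4 (p. 72)] [cite: GortzWedhorn2023, Prop. 27.187] -/
theorem kerRank_fibreHom_dualIsogenyOver_le {Ω : Type u} [Field Ω] [IsAlgClosed Ω] [CharZero Ω] (t : Spec (.of Ω) ⟶ S)
    (hψ : IsIsogeny (fibreHom ψ t)) [IsMonHom (dualIsogenyOver ψ D' DB)] :
    Hom.kerRank (fibreHom (dualIsogenyOver ψ D' DB) t) ≤ Hom.kerRank (fibreHom ψ t) := by
  haveI := hψ.etale
  have hd : IsIsogeny (fibreHom (dualIsogenyOver ψ D' DB) t) := isIsogeny_fibreHom_dualIsogenyOver ψ D' DB hD' hDB t hψ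
  rw [← hd.natCard_kerPoints_eq_kerRank_of_charZero Ω, ← hψ.natCard_kerPoints_eq_kerRank_of_charZero Ω]
  exact natCard_kerPoints_fibreHom_dualIsogenyOver_le ψ D' DB hD' t hψ

end DualPair

/-! ## §3 Over a field base `S = Spec k`: the fibre at a point has the degree of the homomorphism itself -/

section FieldBase

variable {k : Type u} [Field k] {X Y : AbelianSchemeOver (Spec (.of k))} (φ : X.X ⟶ Y.X) [IsMonHom φ]

/-- **An isogeny over `Spec k` has isogenous fibres at every field-valued point** (`φ_t = φ ×_k Ω`: surjectivity and finiteness are stable under base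
change, Mathlib `MorphismProperty.of_isPullback` on ★ `Limits.isPullback_pullback_map_left`). [cite: GortzWedhorn2023, Def. 27.176 and Cor. 27.177 (1)]
[cite: GortzWedhorn2020, Section (4.7) (pp. 107–108)] -/
theorem isIsogeny_fibreHom_of_isIsogeny_homOfIsMonHom (hφ : IsIsogeny (homOfIsMonHom φ)) {Ω : Type u} [Field Ω]
    (t : Spec (.of Ω) ⟶ Spec (.of k)) : IsIsogeny (fibreHom φ t) := by
  obtain ⟨hs, hf⟩ := hφ
  change Surjective φ.left at hs
  change IsFinite φ.left at hf
  have sq := (Literature.AlgebraicGeometry.Limits.isPullback_pullback_map_left t φ).flip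
  exact ⟨MorphismProperty.of_isPullback (P := @Surjective) sq hs, MorphismProperty.of_isPullback (P := @IsFinite) sq hf⟩

/-- **`deg φ_t = deg φ` over a field base**: for an isogeny `φ` of abelian `k`-schemes and any field-valued point `t : Spec Ω → Spec k`, the fibre
isogeny `φ_t` has the degree of `φ` — both are the rank of the finite flat `φ` at a point (★ `IsIsogeny.finrank_eq_kerRank` twice, Mathlib
`Scheme.Hom.finrank_of_isPullback` on ★ `Limits.isPullback_pullback_map_left`; cf. ★ `finrank_left_fst_eq_kerRank_fibreHom`).
[cite: GortzWedhorn2023, Def. 27.176 and Cor. 27.177 (1)] [cite: GortzWedhorn2020, Section (4.7) (pp. 107–108)] -/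
theorem kerRank_fibreHom_eq_kerRank_homOfIsMonHom (hφ : IsIsogeny (homOfIsMonHom φ)) {Ω : Type u} [Field Ω]
    (t : Spec (.of Ω) ⟶ Spec (.of k)) : Hom.kerRank (fibreHom φ t) = Hom.kerRank (homOfIsMonHom φ) := by
  have hφt := isIsogeny_fibreHom_of_isIsogeny_homOfIsMonHom φ hφ t
  haveI : Flat φ.left := hφ.flat
  haveI : IsFinite φ.left := hφ.2
  -- a point of the fibre `Y_t`: the image of the closed point under the unit section
  let y' : ↥(pullback Y.X.hom t) := (Y.baseChange t).unitSection.base (IsLocalRing.closedPoint Ω)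
  have h1 := Scheme.Hom.finrank_of_isPullback _ _ _ _ (Literature.AlgebraicGeometry.Limits.isPullback_pullback_map_left t φ).flip y'
  have h2 := hφt.finrank_eq_kerRank y'
  have h3 := hφ.finrank_eq_kerRank ((pullback.fst Y.X.hom t) y')
  change Scheme.Hom.finrank ((Over.pullback t).map φ).left y' = _ at h2
  change Scheme.Hom.finrank φ.left _ = _ at h3
  exact h2.symm.trans (h1.trans h3)

namespace DualPair

variable {A' B : AbelianSchemeOver (Spec (.of k))} (ψ : A'.X ⟶ B.X) [IsMonHom ψ] (D' : A'.DualPair) (DB : B.DualPair)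
  (hD' : Nonempty ((Scheme.Modules.pullback (unitHatSlice D')).obj D'.P ≅ SheafOfModules.unit _))
  (hDB : Nonempty ((Scheme.Modules.pullback (unitHatSlice DB)).obj DB.P ≅ SheafOfModules.unit _))

/-- `ψ^∨` read as a morphism of abelian varieties (★ `dualHom`) IS ★ `homOfIsMonHom` of the `Over (Spec k)`-homomorphism ★ `dualIsogenyOver`
(same underlying morphism, ★ `dualHom_hom`). [cite: MumfordAV1970, §15 Thm. 1 (p. 143)] -/
theorem dualHom_eq_homOfIsMonHom [IsMonHom (dualIsogenyOver ψ D' DB)] :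
    dualHom ψ D' DB hD' hDB = homOfIsMonHom (dualIsogenyOver ψ D' DB) :=
  AbelianVariety.hom_ext _ _ (dualHom_hom ψ D' DB hD' hDB)

include hD' hDB in
/-- **`deg ψ^∨ ≤ deg ψ` OVER AN ALGEBRAICALLY CLOSED FIELD OF CHARACTERISTIC `0`**: §2 at the tautological point `𝟙 : Spec k → Spec k` (`ψ^∨` is a
homomorphism over the reduced base `Spec k`, ★ `isMonHom_dualIsogenyOver`), transported to `ψ` and `ψ^∨` themselves by §3
`kerRank_fibreHom_eq_kerRank_homOfIsMonHom`. [cite: MumfordAV1970, §15 Thm. 1 (p. 143)] [cite: GortzWedhorn2023, Prop. 27.213 (3) (p. 687)] -/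
theorem kerRank_dualHom_le [IsAlgClosed k] [CharZero k] (hψ : IsIsogeny (homOfIsMonHom ψ)) :
    Hom.kerRank (dualHom ψ D' DB hD' hDB) ≤ Hom.kerRank (homOfIsMonHom ψ) := by
  haveI : IsMonHom (dualIsogenyOver ψ D' DB) := isMonHom_dualIsogenyOver ψ D' DB hDB hD'
  have hd : IsIsogeny (homOfIsMonHom (dualIsogenyOver ψ D' DB)) := by
    rw [← dualHom_eq_homOfIsMonHom ψ D' DB hD' hDB]; exact isIsogeny_dualHom ψ D' DB hD' hDB hψ
  have h := kerRank_fibreHom_dualIsogenyOver_le ψ D' DB hD' hDB (𝟙 (Spec (.of k)))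
    (isIsogeny_fibreHom_of_isIsogeny_homOfIsMonHom ψ hψ _)
  rw [kerRank_fibreHom_eq_kerRank_homOfIsMonHom ψ hψ, kerRank_fibreHom_eq_kerRank_homOfIsMonHom (dualIsogenyOver ψ D' DB) hd] at h
  rwa [dualHom_eq_homOfIsMonHom]

/-! ## §4 The squeeze: `deg ψ^∨ = deg ψ` -/

include hD' hDB in
/-- **THE DEGREE OF THE DUAL ISOGENY: `deg ψ^∨ = deg ψ`** for an isogeny `ψ : A′ → B` of abelian schemes over an algebraically closed field of
characteristic `0` with unit-normalised dual pairs ([MumfordAV1970] §15 Thm. 1; [GortzWedhorn2023] Prop. 27.213 (3)).  PROOF WITHOUT CARTIER DUALITY: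
a quasi-inverse `g` with `g ≫ ψ = [n]_B` (★ `IsIsogeny.exists_nsmul_inverse_holds`) gives `deg g · deg ψ = n^{2 dim B}` (★
`IsIsogeny.kerRank_mul_eq_of_comp_eq_nsmul_id`) and `deg ψ^∨ · deg g^∨ = n^{2 dim B̂} = n^{2 dim B}` (★ `kerRank_dualHom_mul_kerRank_dualHom_eq`, ★
`dim_hat_toAbelianVariety_eq_of_isOfRelDim` with ★ `isOfRelDim_hat`); §3 gives `deg ψ^∨ ≤ deg ψ` and `deg g^∨ ≤ deg g`; squeeze.
[cite: MumfordAV1970, §15 Thm. 1 (p. 143); §19 Remark (p. 169)] [cite: GortzWedhorn2023, Prop. 27.213 (3) (p. 687); Prop. 27.186] -/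
theorem kerRank_dualHom_eq [IsAlgClosed k] [CharZero k] (hψ : IsIsogeny (homOfIsMonHom ψ)) :
    Hom.kerRank (dualHom ψ D' DB hD' hDB) = Hom.kerRank (homOfIsMonHom ψ) := by
  -- a quasi-inverse `g` of `ψ` (as morphisms of abelian varieties): `ψ ≫ g = [n]`, `g ≫ ψ = [n]`
  obtain ⟨g, n, hn, hψg, hgψ⟩ := IsIsogeny.exists_nsmul_inverse_holds hψ
  have hn' : n ≠ 0 := Nat.pos_iff_ne_zero.mp hn
  have hnz : ((n : ℕ) : ℤ) ≠ 0 := Int.natCast_ne_zero.mpr hn'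
  have hnA : IsIsogeny (n • 𝟙 A'.toAffine.toAbelianVariety) := by
    rw [← natCast_zsmul]; exact isIsogeny_zsmul_id_holds _ _ hnz
  have hnB : IsIsogeny (n • 𝟙 B.toAffine.toAbelianVariety) := by
    rw [← natCast_zsmul]; exact isIsogeny_zsmul_id_holds _ _ hnz
  have hgiso : IsIsogeny g :=
    isIsogeny_of_isIsogeny_comp_of_isIsogeny_comp (by rw [hgψ]; exact hnB) (by rw [hψg]; exact hnA)
  -- `g` read back as an `Over (Spec k)`-homomorphism `g₀`, with `g₀ ≫ ψ = [n]_B`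
  set g₀ : B.X ⟶ A'.X := g.hom.hom.hom with hg₀def
  have hg₀ : homOfIsMonHom g₀ = g := AbelianVariety.hom_ext _ _ rfl
  have hg₀iso : IsIsogeny (homOfIsMonHom g₀) := by rw [hg₀]; exact hgiso
  have hcomp : g₀ ≫ ψ = B.mulN n := by
    rw [mulN_eq_hom_zsmul_id, natCast_zsmul, ← hgψ]; rfl
  -- the two product laws: `deg g · deg ψ = n^{2 dim B}`, `deg ψ^∨ · deg g^∨ = n^{2 dim B̂} = n^{2 dim B}`
  have h1 : Hom.kerRank g * Hom.kerRank (homOfIsMonHom ψ) = n ^ (2 * B.toAffine.toAbelianVariety.dim) :=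
    IsIsogeny.kerRank_mul_eq_of_comp_eq_nsmul_id hgiso hψ hn' hgψ
  have h2 := kerRank_dualHom_mul_kerRank_dualHom_eq ψ D' DB hD' hDB hψ g₀ hg₀iso hn' hcomp
  have hdim : DB.hat.toAffine.toAbelianVariety.dim = B.toAffine.toAbelianVariety.dim :=
    DB.dim_hat_toAbelianVariety_eq_of_isOfRelDim (isOfRelDim_dim_toAffine B) (DB.isOfRelDim_hat (isOfRelDim_dim_toAffine B))
  rw [hdim, ← h1] at h2
  -- the two inequalities `deg ψ^∨ ≤ deg ψ`, `deg g^∨ ≤ deg g`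
  have i1 := kerRank_dualHom_le ψ D' DB hD' hDB hψ
  have i2 := kerRank_dualHom_le g₀ DB D' hDB hD' hg₀iso
  rw [hg₀] at i2
  -- squeeze
  have hb : 0 < Hom.kerRank g := Nat.pos_of_ne_zero fun h0 => by
    rw [h0, zero_mul] at h1; exact pow_ne_zero _ hn' h1.symm
  refine le_antisymm i1 (Nat.le_of_mul_le_mul_right ?_ hb)
  calc Hom.kerRank (homOfIsMonHom ψ) * Hom.kerRank g = Hom.kerRank g * Hom.kerRank (homOfIsMonHom ψ) := mul_comm _ _
    _ = Hom.kerRank (dualHom ψ D' DB hD' hDB) * Hom.kerRank (dualHom g₀ DB D' hDB hD') := h2.symm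
    _ ≤ Hom.kerRank (dualHom ψ D' DB hD' hDB) * Hom.kerRank g := Nat.mul_le_mul_left _ i2

include hD' hDB in
/-- **`#Ker ψ^∨(k) = #Ker ψ(k)`** — the `k`-points twin (`k = k̄` of characteristic `0`: `#Ker(k) = deg`, ★ `IsIsogeny.natCard_kerPoints_eq_kerRank_of_charZero`):
the count consumed by the (ρ2‴)∕(ρ-deg)(i) degree chains of the crux hLiu418. [cite: MumfordAV1970, §15 Thm. 1 (p. 143); §7 Thm. 4 (p. 72)] -/
theorem natCard_kerPoints_dualHom_eq [IsAlgClosed k] [CharZero k] (hψ : IsIsogeny (homOfIsMonHom ψ)) :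
    Nat.card (Hom.kerPoints (specOver k k) (dualHom ψ D' DB hD' hDB)) = Nat.card (Hom.kerPoints (specOver k k) (homOfIsMonHom ψ)) := by
  rw [(isIsogeny_dualHom ψ D' DB hD' hDB hψ).natCard_kerPoints_eq_kerRank_of_charZero k,
    hψ.natCard_kerPoints_eq_kerRank_of_charZero k, kerRank_dualHom_eq ψ D' DB hD' hDB hψ]

end DualPair

end FieldBase

/-- **[GortzWedhorn2023] Prop. 27.213 (3) «`deg(f) = deg(f^t)`» FOR ALGEBRAICALLY CLOSED FIELDS OF CHARACTERISTIC `0`** — the body of the named fact ★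
`GortzWedhorn2023.Ch27DualityRows.Prop_27_213_3_deg` (which quantifies over ALL fields and stays a named fact in general) in its own binder shape,
restricted to `k = k̄`, `char k = 0`, and PROVED (§4 `kerRank_dualHom_eq`). [cite: GortzWedhorn2023, Prop. 27.213 (3) (p. 687)]
[cite: MumfordAV1970, §15 Thm. 1 (p. 143)] -/
theorem DualPair.prop_27_213_3_deg_of_isAlgClosed_of_charZero (k : Type) [Field k] [IsAlgClosed k] [CharZero k]
    (A' B : AbelianSchemeOver (Spec (.of k))) (ψ : A'.X ⟶ B.X) [IsMonHom ψ] (D' : A'.DualPair) (DB : B.DualPair)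
    (hD' : Nonempty ((Scheme.Modules.pullback (DualPair.unitHatSlice D')).obj D'.P ≅ SheafOfModules.unit _))
    (hDB : Nonempty ((Scheme.Modules.pullback (DualPair.unitHatSlice DB)).obj DB.P ≅ SheafOfModules.unit _))
    (hψ : IsIsogeny (homOfIsMonHom ψ)) :
    Hom.kerRank (DualPair.dualHom ψ D' DB hD' hDB) = Hom.kerRank (homOfIsMonHom ψ) :=
  DualPair.kerRank_dualHom_eq ψ D' DB hD' hDB hψ



end AbelianSchemeOver

end Literature.AlgebraicGeometry.AbelianSchemes
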